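import Literature.MathematicalPhysics.QuantumManyBody.ScatteringLengthRange
import Literature.MathematicalPhysics.QuantumManyBody.HardCoreScatteringLength
import HarnessLib

/-!
# Discharge of `LSSY2005_scatteringLength_le_range`

The named fact `Literature.MathematicalPhysics.QuantumManyBody.BoseGas.LSSY2005_scatteringLength_le_range`
(LSSY 2005, App. C, Remark 2 after Thm. C.1: a finite-range repulsive potential has scattering
length `a ≤ R₀`) is an immediate consequence of the tree's PROVED theorem
`Literature.MathematicalPhysics.QuantumManyBody.BoseGas.scatteringLength_le_range`
(`HardCoreScatteringLength.lean`: `0 ≤ R → (∀ r, R < r → v r = 0) → scatteringLength v ≤ ENNReal.ofReal R`,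
any `v : ℝ → ℝ≥0∞`, hard cores allowed; proved there by the test functions approximating
`max{0, 1 - R'/|x|}`, `R' ↓ R`). This file records the discharge (`_holds`), so the fact carries no
debt (D-0014/D-0026). Nothing else is here.

## References
* [LSSY2005] Lieb–Seiringer–Solovej–Yngvason, *The Mathematics of the Bose Gas and its
  Condensation*, Birkhäuser 2005, App. C: (C.1), Thm. C.1 (C.7)–(C.8), Remark 2.
-/

noncomputable section

open scoped ENNReal

namespace Literature.MathematicalPhysics.QuantumManyBody.BoseGas

/-- **DISCHARGE of the named fact `LSSY2005_scatteringLength_le_range`** (LSSY 2005, App. C,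
Remark 2: `a ≤ R₀` for a potential vanishing beyond `R₀ ≥ 0`), by the tree's theorem
`scatteringLength_le_range`; the measurability hypothesis of the fact is not even needed.
[cite: LSSY2005, App. C, Theorem C.1 (C.7)–(C.8) and Remark 2, with (C.1)] -/
theorem LSSY2005_scatteringLength_le_range_holds : LSSY2005_scatteringLength_le_range :=
  fun _v _R₀ _hv hR h => scatteringLength_le_range hR h

end Literature.MathematicalPhysics.QuantumManyBody.BoseGas

end
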